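import Mathlib.Tactic.IntervalCases
import Literature.Topology.FourManifolds.SPC4Wave0
import Literature.Topology.FourManifolds.SphereSimplyConnected
import Literature.Topology.FourManifolds.HomotopyS4CompactProofs
import HarnessLib

/-!
# The smooth Poincaré conjecture in dimensions `1`, `2`, `3`: the low-dimensional leaves of Kervaire–Milnor's Theorem 1.1

Topic `Literature/Topology/FourManifolds`, sibling of `SPC4Wave0.lean`, which vendors
spc4.S32 (`Literature.Topology.FourManifolds.nonemptyDiffeomorphSphere_of_mem`: the smooth
Poincaré conjecture in ALL dimensions `1, 2, 3, 5, 6, 12, 56, 61` in which it is known) and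
spc4.S31 (`Literature.Topology.FourManifolds.nonempty_diffeomorph_sphere_three`: a closed simply
connected smooth `3`-manifold is diffeomorphic to `S³` — Perelman; and its topological form
`nonempty_homeomorph_sphere_three`), and of the `HomotopySpheresGroup*.lean` files
(Kervaire–Milnor's Theorem 1.1 for `Θₙ`, decomposed).

The proof of Theorem 1.1 for the oriented-diffeomorphism quotient `Θₙ = HomotopySphereClass n`
uses the Poincaré conjecture only in dimensions `1, 2, 3` (Kervaire–Milnor, *Groups of homotopy
spheres I*, Ann. of Math. 77 (1963), p. 507: "Clearly `Θ₁` is zero. For `n ≤ 3`, Munkres and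
Whitehead have proved that a topological `n`-manifold has a differentiable structure which is
unique up to diffeomorphism. It follows that `Θ₂ = 0`. If the Poincaré hypothesis were proved,
it would follow that `Θ₃` is zero"), whereas the dimensions `5, 6, 12, 56, 61` of spc4.S32 are
consequences of the computation of `Θₙ` itself (Kervaire–Milnor Part II; Wang–Xu 2017). The
assembly `Literature.Topology.FourManifolds.exists_commGroup_homotopySphereClass_of_fiveLeaves`
(`HomotopySpheresGroupLeaves.lean`) therefore takes the smooth Poincaré conjecture in dimensions
`1 ≤ n ≤ 3` only, in the shape of spc4.S32 (Mathlib's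
`ContinuousMap.HomotopyEquiv.NonemptyDiffeomorphSphere M n` for Hausdorff second countable `M`).
This file supplies that hypothesis from three separately citable statements:

* `Literature.Topology.FourManifolds.nonemptyDiffeomorphSphere_one` (NEW named fact) —
  classification of smooth curves (Milnor, *Topology from the differentiable viewpoint*, Appendix;
  Lee, *Introduction to Smooth Manifolds*, Problem 15-13);
* `Literature.Topology.FourManifolds.nonemptyDiffeomorphSphere_two` (NEW named fact) —
  classification of closed surfaces (Kervaire–Milnor p. 507 via Munkres, Whitehead; Hirsch,
  *Differential Topology*, Ch. 9, Thm. 3.5);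
* dimension `3` is NOT a new fact: it is the existing spc4.S31, `nonempty_diffeomorph_sphere_three`
  (Perelman; Morgan–Tian 2007, Cor. 0.2 (a)), brought into the spc4.S32 shape by the PROVED
  `nonemptyDiffeomorphSphere_three_of` — a manifold homotopy equivalent to `𝕊³` is simply
  connected (`π₁(S³) = 1`, homotopy invariance) and compact, the latter by the general PROVED
  `compactSpace_of_homotopyEquiv_sphere` (a Hausdorff second countable `n`-manifold homotopy
  equivalent to `𝕊ⁿ`, `n ≥ 1`, is compact: `Hₙ(Sⁿ; ℤ) ≠ 0` while a connected non-compact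
  `n`-manifold has `Hₙ = 0`, Hatcher Prop. 3.29 — both inputs are theorems of the tree's singular
  homology layer; this is the all-`n` form of `compactSpace_of_homotopyEquiv_sphere_four_holds`).

Proved glue: `nonemptyDiffeomorphSphere_one_of_mem`, `…_two_of_mem`, `…_three_of_mem` (each
dimension is an instance of spc4.S32); `nonemptyDiffeomorphSphere_of_eq_one_or_eq_two` (the
`n = 1 ∨ n = 2` shape consumed by `HomotopySphere.contractibleSpace_compl_image_ball_of`,
`HomotopySpheresSumProofs.lean`); `nonemptyDiffeomorphSphere_of_le_three` (the `1 ≤ n ≤ 3` shape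
consumed by `exists_commGroup_homotopySphereClass_of_fiveLeaves`, from the two new facts and
spc4.S31).

Not restated here: spc4.S31 (`nonempty_homeomorph_sphere_three`, `nonempty_diffeomorph_sphere_three`),
spc4.S32 (`nonemptyDiffeomorphSphere_of_mem`) and the smoothing theory spc4.S33 (`SPC4Wave0.lean`).

## References

* M. Kervaire, J. Milnor, *Groups of homotopy spheres I*, Ann. of Math. (2) 77 (1963), 504–537,
  §2 p. 507. doi:10.2307/1970128 [KervaireMilnorAnnals1963]
* J. Milnor, *Topology from the differentiable viewpoint*, Univ. Press of Virginia (1965),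
  Appendix "Classifying 1-manifolds". [MilnorTDV1965]
* J. M. Lee, *Introduction to Smooth Manifolds*, 2nd ed., GTM 218, Springer (2013), Problem 15-13
  (classification of smooth 1-manifolds). [LeeSmoothManifolds2013]
* M. W. Hirsch, *Differential Topology*, GTM 33, Springer (1976), Ch. 9, Thm. 3.5 (classification
  of compact orientable surfaces). [HirschDT1976]
* J. Morgan, G. Tian, *Ricci flow and the Poincaré conjecture*, Clay Math. Monographs 3, AMS
  (2007), Cor. 0.2 (a); arXiv:math/0607607. [MorganTian2007]
* A. Hatcher, *Algebraic Topology*, CUP (2002), Prop. 1.14, Cor. 2.11, Cor. 2.14, Prop. 3.29.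
  [HatcherAT2002]
-/

noncomputable section

open CategoryTheory Limits ContinuousMap
open scoped Manifold ContDiff

namespace Literature.Topology.FourManifolds

universe u

/-! ### Dimensions `1` and `2`: named facts -/

/-- **The smooth Poincaré conjecture in dimension `1` (classification of curves).** Every
Hausdorff, second countable smooth `1`-manifold (modelled on `ℝ¹`, without boundary) which is
homotopy equivalent to the circle `𝕊¹` is diffeomorphic to `𝕊¹` — in Mathlib's form
`ContinuousMap.HomotopyEquiv.NonemptyDiffeomorphSphere M 1`, the dimension-`1` instance of the
tree fact `nonemptyDiffeomorphSphere_of_mem` (spc4.S32). Source: a connected smooth `1`-manifold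
is diffeomorphic either to the circle or to an interval of real numbers, so a manifold homotopy
equivalent to `𝕊¹` is connected and not contractible, hence is the circle (Milnor, *Topology from
the differentiable viewpoint* (1965), Appendix "Classifying 1-manifolds"; Lee, *Introduction to
Smooth Manifolds*, 2nd ed., Problem 15-13: "Let `M` be a connected smooth 1-manifold. Show that `M`
is diffeomorphic to either `ℝ` or `𝕊¹`"). This is Kervaire–Milnor's "Clearly `Θ₁` is zero"
(*Groups of homotopy spheres I* (1963), p. 507). Compactness is not assumed (it follows).
[cite: MilnorTDV1965, Appendix (Classifying 1-manifolds)] [cite: LeeSmoothManifolds2013, Problem 15-13] [cite: KervaireMilnorAnnals1963, §2 p. 507] -/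
def nonemptyDiffeomorphSphere_one : Prop :=
  ∀ (M : Type u) [TopologicalSpace M] [T2Space M] [SecondCountableTopology M],
    ContinuousMap.HomotopyEquiv.NonemptyDiffeomorphSphere M 1

/-- **The smooth Poincaré conjecture in dimension `2` (classification of surfaces).** Every
Hausdorff, second countable smooth `2`-manifold (modelled on `ℝ²`, without boundary) which is
homotopy equivalent to `𝕊²` is diffeomorphic to `𝕊²` — `NonemptyDiffeomorphSphere M 2`, the
dimension-`2` instance of spc4.S32. Source: Kervaire–Milnor, *Groups of homotopy spheres I*
(1963), p. 507: "For `n ≤ 3`, Munkres [19] and Whitehead [31] have proved that a topological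
`n`-manifold has a differentiable structure which is unique up to diffeomorphism. It follows that
`Θ₂ = 0`" — i.e. a homotopy `2`-sphere (compact: `H₂ ≠ 0`; simply connected) is homeomorphic to
`S²` by the classification of closed surfaces and hence diffeomorphic to it; in the smooth
category directly: a compact connected orientable surface without boundary is a sphere with `p`
handles, `χ = 2 - 2p` (Hirsch, *Differential Topology* (1976), Ch. 9, Thm. 3.5), so a compact simply
connected surface (`χ = 2`, orientable) is diffeomorphic to `S²`.
[cite: KervaireMilnorAnnals1963, §2 p. 507] [cite: HirschDT1976, Ch. 9 Thm. 3.5] -/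
def nonemptyDiffeomorphSphere_two : Prop :=
  ∀ (M : Type u) [TopologicalSpace M] [T2Space M] [SecondCountableTopology M],
    ContinuousMap.HomotopyEquiv.NonemptyDiffeomorphSphere M 2

/-- The dimension-`1` statement is an instance of spc4.S32 (`nonemptyDiffeomorphSphere_of_mem`,
`1 ∈ {1, 2, 3, 5, 6, 12, 56, 61}`). [cite: KervaireMilnorAnnals1963, §2 p. 507] -/
theorem nonemptyDiffeomorphSphere_one_of_mem (h : nonemptyDiffeomorphSphere_of_mem.{u}) :
    nonemptyDiffeomorphSphere_one.{u} :=
  fun M _ _ _ => h 1 (by simp) M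

/-- The dimension-`2` statement is an instance of spc4.S32 (`nonemptyDiffeomorphSphere_of_mem`,
`2 ∈ {1, 2, 3, 5, 6, 12, 56, 61}`). [cite: KervaireMilnorAnnals1963, §2 p. 507] -/
theorem nonemptyDiffeomorphSphere_two_of_mem (h : nonemptyDiffeomorphSphere_of_mem.{u}) :
    nonemptyDiffeomorphSphere_two.{u} :=
  fun M _ _ _ => h 2 (by simp) M

/-- **The smooth Poincaré conjecture in dimensions `1, 2` in the shape `n = 1 ∨ n = 2`** consumed
by `HomotopySphere.contractibleSpace_compl_image_ball_of` (`HomotopySpheresSumProofs.lean`) and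
`exists_commGroup_homotopySphereClass_of_fiveLeaves`, from the two named facts
(Kervaire–Milnor 1963, p. 507: `Θ₁ = Θ₂ = 0`). [cite: KervaireMilnorAnnals1963, §2 p. 507] -/
theorem nonemptyDiffeomorphSphere_of_eq_one_or_eq_two (h1 : nonemptyDiffeomorphSphere_one.{u})
    (h2 : nonemptyDiffeomorphSphere_two.{u}) :
    ∀ n : ℕ, n = 1 ∨ n = 2 → ∀ (M : Type u) [TopologicalSpace M] [T2Space M]
      [SecondCountableTopology M], ContinuousMap.HomotopyEquiv.NonemptyDiffeomorphSphere M n := by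
  rintro n (rfl | rfl)
  · exact h1
  · exact h2

/-! ### Manifolds homotopy equivalent to a sphere are compact -/

/-- The standard sphere `𝕊ⁿ ⊂ ℝⁿ⁺¹`, `n ≥ 1`, is path connected (Mathlib `isPathConnected_sphere`,
as `1 < n + 1 = rank ℝⁿ⁺¹`); the all-`n` form of `pathConnectedSpace_sphere_four`. [folklore] -/
theorem pathConnectedSpace_euclideanSphere {n : ℕ} (hn : 1 ≤ n) :
    PathConnectedSpace (Metric.sphere (0 : EuclideanSpace ℝ (Fin (n + 1))) 1) := by
  refine isPathConnected_iff_pathConnectedSpace.mp (isPathConnected_sphere ?_ 0 zero_le_one)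
  rw [← Module.finrank_eq_rank, finrank_euclideanSpace_fin]
  exact Nat.one_lt_cast.mpr (by omega)

/-- **A manifold homotopy equivalent to `Sⁿ` is closed.** Every Hausdorff, second countable
topological `n`-manifold `M` (charts in `ℝⁿ`), `n ≥ 1`, which is homotopy equivalent to `𝕊ⁿ` is
compact: `M` is path connected as `𝕊ⁿ` is; if it were not compact then `Hₙ(M; ℤ) = 0` (Hatcher,
*Algebraic Topology* (2002), Prop. 3.29: a connected non-compact `n`-manifold has `Hᵢ = 0` for
`i ≥ n`; tree theorem `isZero_singularHomology_of_noncompactSpace_holds`), contradicting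
`Hₙ(𝕊ⁿ; ℤ) ≠ 0` (Cor. 2.14; tree theorem `not_isZero_singularHomology_unitSphere`) and the
homotopy invariance of homology (Cor. 2.11; `singularHomology.isoOfHomotopyEquiv`). The homology
runs in `Type`: `M : Type u` is first shrunk to `Shrink.{0} M` (second countable `T₁` spaces are
small, `small_of_secondCountableTopology`), exactly as in the dimension-`4` theorem
`compactSpace_of_homotopyEquiv_sphere_four_holds` (`HomotopyS4CompactProofs.lean`), of which this
is the all-`n` form. [cite: HatcherAT2002, Prop. 3.29, Cor. 2.11, Cor. 2.14] -/
theorem compactSpace_of_homotopyEquiv_sphere {n : ℕ} (hn : 1 ≤ n) (M : Type u)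
    [TopologicalSpace M] [T2Space M] [SecondCountableTopology M]
    [ChartedSpace (EuclideanSpace ℝ (Fin n)) M]
    (e : M ≃ₕ Metric.sphere (0 : EuclideanSpace ℝ (Fin (n + 1))) 1) : CompactSpace M := by
  by_contra hM
  haveI : NoncompactSpace M := not_compactSpace_iff.mp hM
  haveI : Small.{0} M := small_of_secondCountableTopology M
  let φ : M ≃ₜ Shrink.{0} M := Shrink.homeomorph M
  haveI : T2Space (Shrink.{0} M) := φ.t2Space
  letI : ChartedSpace M (Shrink.{0} M) :=
    φ.symm.toOpenPartialHomeomorph.singletonChartedSpace rfl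
  letI : ChartedSpace (EuclideanSpace ℝ (Fin n)) (Shrink.{0} M) :=
    ChartedSpace.comp (EuclideanSpace ℝ (Fin n)) M (Shrink.{0} M)
  haveI : NoncompactSpace (Shrink.{0} M) :=
    not_compactSpace_iff.mp fun _ => hM φ.symm.compactSpace
  let e₀ : Shrink.{0} M ≃ₕ Metric.sphere (0 : EuclideanSpace ℝ (Fin (n + 1))) 1 :=
    φ.symm.toHomotopyEquiv.trans e
  haveI := pathConnectedSpace_euclideanSphere hn
  haveI : PathConnectedSpace (Shrink.{0} M) := pathConnectedSpace_of_homotopyEquiv e₀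
  have hz : IsZero (Literature.AlgebraicTopology.SingularHomology.singularHomology ℤ ℤ
      (Shrink.{0} M) n) :=
    Literature.AlgebraicTopology.SingularHomology.isZero_singularHomology_of_noncompactSpace_holds
      ℤ (Shrink.{0} M) n le_rfl
  exact Literature.AlgebraicTopology.SingularHomology.not_isZero_singularHomology_unitSphere ℤ ℤ n hn
    (hz.of_iso (Literature.AlgebraicTopology.SingularHomology.singularHomology.isoOfHomotopyEquiv
      ℤ ℤ e₀ n).symm)

/-! ### Dimension `3`: spc4.S31 in the shape of spc4.S32 -/

/-- **The smooth Poincaré conjecture in dimension `3` in the shape of spc4.S32, from spc4.S31.**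
GIVEN Perelman's theorem as vendored in the tree (`nonempty_diffeomorph_sphere_three`, spc4.S31,
smooth form: a closed simply connected smooth `3`-manifold is diffeomorphic to `S³`; Morgan–Tian,
*Ricci flow and the Poincaré conjecture* (2007), Cor. 0.2 (a)), every Hausdorff second countable
smooth `3`-manifold homotopy equivalent to `𝕊³` is diffeomorphic to `𝕊³`
(`NonemptyDiffeomorphSphere M 3`): such a manifold is simply connected (`π₁(S³) = 1`, Hatcher
Prop. 1.14, `simplyConnectedSpace_euclideanSphere`, and homotopy invariance, Mathlib's
`ContinuousMap.HomotopyEquiv.simplyConnectedSpace`) and compact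
(`compactSpace_of_homotopyEquiv_sphere`). Kervaire–Milnor (1963), p. 507: "If the Poincaré
hypothesis were proved, it would follow that `Θ₃` is zero."
[cite: MorganTian2007, Cor. 0.2 (a)] [cite: KervaireMilnorAnnals1963, §2 p. 507] -/
theorem nonemptyDiffeomorphSphere_three_of (h : nonempty_diffeomorph_sphere_three.{u})
    (M : Type u) [TopologicalSpace M] [T2Space M] [SecondCountableTopology M] :
    ContinuousMap.HomotopyEquiv.NonemptyDiffeomorphSphere M 3 := by
  intro _ _ e
  haveI : CompactSpace M := compactSpace_of_homotopyEquiv_sphere (n := 3) (by norm_num) M e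
  haveI := simplyConnectedSpace_euclideanSphere (n := 3) (by norm_num)
  haveI : SimplyConnectedSpace M := e.simplyConnectedSpace
  exact h M

/-- The dimension-`3` statement in the shape of spc4.S32 is also an instance of spc4.S32 itself
(`nonemptyDiffeomorphSphere_of_mem`, `3 ∈ {1, 2, 3, 5, 6, 12, 56, 61}`). [cite: MorganTian2007, Cor. 0.2 (a)] -/
theorem nonemptyDiffeomorphSphere_three_of_mem (h : nonemptyDiffeomorphSphere_of_mem.{u})
    (M : Type u) [TopologicalSpace M] [T2Space M] [SecondCountableTopology M] :
    ContinuousMap.HomotopyEquiv.NonemptyDiffeomorphSphere M 3 :=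
  h 3 (by simp) M

/-! ### Dimensions `1 ≤ n ≤ 3` together -/

/-- **The smooth Poincaré conjecture in dimensions `1 ≤ n ≤ 3`**, in the shape consumed by
`exists_commGroup_homotopySphereClass_of_fiveLeaves` (`HomotopySpheresGroupLeaves.lean`), from the
two named facts of this file (dimensions `1`, `2`: classification of curves and surfaces;
Kervaire–Milnor 1963, p. 507) and spc4.S31 (dimension `3`: Perelman; via
`nonemptyDiffeomorphSphere_three_of`). [cite: KervaireMilnorAnnals1963, §2 p. 507] [cite: MorganTian2007, Cor. 0.2 (a)] -/
theorem nonemptyDiffeomorphSphere_of_le_three (h1 : nonemptyDiffeomorphSphere_one.{u})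
    (h2 : nonemptyDiffeomorphSphere_two.{u}) (h3 : nonempty_diffeomorph_sphere_three.{u}) :
    ∀ n : ℕ, 1 ≤ n → n ≤ 3 → ∀ (M : Type u) [TopologicalSpace M] [T2Space M]
      [SecondCountableTopology M], ContinuousMap.HomotopyEquiv.NonemptyDiffeomorphSphere M n := by
  intro n hn1 hn3
  interval_cases n
  · exact h1
  · exact h2
  · exact fun M _ _ _ => nonemptyDiffeomorphSphere_three_of h3 M

end Literature.Topology.FourManifolds
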